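import Summits.Ventures.Crystal3D.Bulk.CapBoxBernstein
import Mathlib.Algebra.Order.Floor.Defs
import Mathlib.Data.Rat.Floor
import Mathlib.Data.List.GetD
import HarnessLib

/-!
# Tensor-Bernstein branch and bound for «`P(u,v,t) ≥ 0` on a box where the Gram determinant is `≥ 0`»

Venture `Crystal3D` (cell `pub-crystal3d`, phase 2; seat typer-bulk). The three-dimensional layer over
`CapBoxBernstein.lean`: dense trivariate tensors `[i][j][k] ↔ uⁱ vʲ tᵏ` (outer axis `u`), their power-form
value `eval3` and Bernstein-form value `val3Q` / `val3N`, and an exact branch and bound whose only arithmetic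
is on natural numbers:

* `toBern3` — power → Bernstein conversion on a box (one Horner pass per axis), `val3Q_toBern3`;
* `toNat3 N M` / `toNat3Up N M` — integerisation `⌊N·b⌋ + M` (lower) resp. `⌈N·b⌉ + M` (upper) with an
  offset `M` making every entry a natural number (`offsetOK`), `val3N_toNat3_le` / `le_val3N_toNat3Up`;
* `splitL` / `splitR` — de Casteljau halving along an axis (scaled by `2ⁿ`), `allGe3` / `allLt3` — sign tests,
  `bnb` — the search: a node `(Y, θ; H, η)` is CERTIFIED if every entry of `Y` is `≥ θ` (then the
  `Y`-value is `≥ θ` on the node's box), or every entry of `H` is `< η` (then the Gram value is `< 0` on the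
  box: no admissible point), or both children are certified (thresholds scale by `2^nY`, `2^nH`);
* `bnb_sound` and the end-to-end statement `nonneg_of_bnb`:
  a `true` run proves `P ≥ 0` at every point of the box with `1 + 2uvt - u² - v² - t² ≥ 0`.

Everything is structurally recursive, so both `decide +kernel` and `native_decide` can run it. HONEST FRAMING:
bookkeeping + one soundness theorem [folklore: Bernstein enclosure and de Casteljau subdivision, e.g.
Garloff 1985 / Farouki 2012]; nothing specific to sphere packings is proved here.
-/

open Finset

namespace Summit.Ventures.Crystal3D.CapCut.Bern

/-! ### Natural-number tensors and the search -/

/-- Scaling of a natural number by `2ᵉ`. [folklore] -/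
def sc0 (e x : ℕ) : ℕ := Nat.mul x (Nat.pow 2 e)
/-- Lines, slices, tensors of natural numbers. [folklore] -/
abbrev T1 := List ℕ
/-- Slices. [folklore] -/
abbrev T2 := List (List ℕ)
/-- Tensors. [folklore] -/
abbrev T3 := List (List (List ℕ))
/-- Elementwise sum of lines. [folklore] -/
def add1 : T1 → T1 → T1 := lzip Nat.add
/-- Elementwise sum of slices. [folklore] -/
def add2 : T2 → T2 → T2 := lzip add1
/-- Scaling of a line by `2ᵉ`. [folklore] -/
def sc1 (e : ℕ) (l : T1) : T1 := l.map (sc0 e)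
/-- Scaling of a slice by `2ᵉ`. [folklore] -/
def sc2 (e : ℕ) (l : T2) : T2 := l.map (sc1 e)

/-- Left child along axis `ax` (`0 = u` outer, `1 = v`, otherwise `t` inner). [folklore] -/
def splitL : ℕ → T3 → T3
  | 0, Z => castL add2 sc2 Z
  | 1, Z => Z.map (castL add1 sc1)
  | _, Z => Z.map (List.map (castL Nat.add sc0))

/-- Right child along axis `ax`. [folklore] -/
def splitR : ℕ → T3 → T3
  | 0, Z => castR add2 sc2 Z
  | 1, Z => Z.map (castR add1 sc1)
  | _, Z => Z.map (List.map (castR Nat.add sc0))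

/-- Every entry is `≥ θ`. [folklore] -/
def allGe3 (θ : ℕ) (Z : T3) : Bool :=
  Z.all fun sl => sl.all fun ln => ln.all fun x => Nat.ble θ x
/-- Every entry is `< θ`. [folklore] -/
def allLt3 (θ : ℕ) (Z : T3) : Bool :=
  Z.all fun sl => sl.all fun ln => ln.all fun x => Nat.blt x θ

/-- Axis cycle `u → v → t → u`. [folklore] -/
def nextAx : ℕ → ℕ
  | 0 => 1
  | 1 => 2
  | _ => 0

/-- The branch and bound on `(Y, θ)` (tensor and threshold of the target) and `(H, η)` (tensor and threshold of
the Gram constraint), degrees `nY` resp. `nH` on every axis; `fuel` bounds the depth. [folklore] -/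
def bnb (nY nH : ℕ) : ℕ → ℕ → T3 → ℕ → T3 → ℕ → Bool
  | 0, _, _, _, _, _ => false
  | fuel + 1, ax, Y, θ, H, η =>
    allGe3 θ Y ||
      (allLt3 η H ||
        (bnb nY nH fuel (nextAx ax) (splitL ax Y) (sc0 nY θ) (splitL ax H) (sc0 nH η) &&
          bnb nY nH fuel (nextAx ax) (splitR ax Y) (sc0 nY θ) (splitR ax H) (sc0 nH η)))

/-! ### Rational tensors, conversion, integerisation -/

/-- Rational lines. [folklore] -/
abbrev QT1 := List ℚ
/-- Rational slices. [folklore] -/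
abbrev QT2 := List (List ℚ)
/-- Rational tensors `[i][j][k] ↔ uⁱ vʲ tᵏ`. [folklore] -/
abbrev QT3 := List (List (List ℚ))

/-- Sum of lines. [folklore] -/
def qadd1 : QT1 → QT1 → QT1 := lzip (· + ·)
/-- Sum of slices. [folklore] -/
def qadd2 : QT2 → QT2 → QT2 := lzip qadd1
/-- Sum of tensors. [folklore] -/
def qadd3 : QT3 → QT3 → QT3 := lzip qadd2
/-- Scalar multiple of a line. [folklore] -/
def qsmul1 (c : ℚ) (l : QT1) : QT1 := l.map (c * ·)
/-- Scalar multiple of a slice. [folklore] -/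
def qsmul2 (c : ℚ) (l : QT2) : QT2 := l.map (qsmul1 c)
/-- Scalar multiple of a tensor. [folklore] -/
def qsmul3 (c : ℚ) (l : QT3) : QT3 := l.map (qsmul2 c)

/-- Bernstein coefficients of a power-form tensor on the box `[lo₀,hi₀] × [lo₁,hi₁] × [lo₂,hi₂]`
(axis `t` first, then `v`, then `u`). [folklore] -/
def toBern3 (lo0 hi0 lo1 hi1 lo2 hi2 : ℚ) (P : QT3) : QT3 :=
  toBern qadd2 qsmul2 lo0 hi0
    (P.map fun sl => toBern qadd1 qsmul1 lo1 hi1 (sl.map fun ln => toBern (· + ·) (· * ·) lo2 hi2 ln))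

/-- Lower integerisation with offset: `⌊N·q⌋ + M` (as a natural number). [folklore] -/
def toNat3 (N M : ℕ) (B : QT3) : T3 :=
  B.map fun sl => sl.map fun ln => ln.map fun q => (⌊(N : ℚ) * q⌋ + M).toNat
/-- No truncation in `toNat3`: every `⌊N·q⌋ + M ≥ 0`. [folklore] -/
def offsetOK (N M : ℕ) (B : QT3) : Bool :=
  B.all fun sl => sl.all fun ln => ln.all fun q => decide (0 ≤ ⌊(N : ℚ) * q⌋ + M)
/-- Upper integerisation with offset: `⌈N·q⌉ + M`. [folklore] -/
def toNat3Up (N M : ℕ) (B : QT3) : T3 :=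
  B.map fun sl => sl.map fun ln => ln.map fun q => (⌈(N : ℚ) * q⌉ + M).toNat
/-- No truncation in `toNat3Up`. [folklore] -/
def offsetOKUp (N M : ℕ) (B : QT3) : Bool :=
  B.all fun sl => sl.all fun ln => ln.all fun q => decide (0 ≤ ⌈(N : ℚ) * q⌉ + M)

/-- The Gram polynomial `1 + 2uvt - u² - v² - t²` as a tensor of shape `3³`. [folklore] -/
def gramQ3 : QT3 :=
  [[[1, 0, -1], [0, 0, 0], [-1, 0, 0]],
   [[0, 0, 0], [0, 2, 0], [0, 0, 0]],
   [[-1, 0, 0], [0, 0, 0], [0, 0, 0]]]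

/-- Shape test: exactly `n+1` slices of `n+1` lines of `n+1` entries. [folklore] -/
def shapeOK3 {β : Type} (n : ℕ) (Z : List (List (List β))) : Bool :=
  Z.length == n + 1 && Z.all fun sl => sl.length == n + 1 && sl.all fun ln => ln.length == n + 1

/-! ### Semantics -/

/-- Power-form value of a rational tensor at `(u, v, t)`. [folklore] -/
def eval3 (P : QT3) (u v t : ℝ) : ℝ :=
  pvF (fun sl => pvF (fun ln => pvF (fun q : ℚ => (q : ℝ)) ln t) sl v) P u

/-- Bernstein-form value (degree `n` on every axis) of a rational tensor at `(s₁, s₂, s₃) ∈ [0,1]³`. [folklore] -/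
def val3Q (n : ℕ) (B : QT3) (s1 s2 s3 : ℝ) : ℝ :=
  bvF (fun sl => bvF (fun ln => bvF (fun q : ℚ => (q : ℝ)) 0 n ln s3) [] n sl s2) [] n B s1

/-- Bernstein-form value (degree `n` on every axis) of a natural-number tensor. [folklore] -/
def val3N (n : ℕ) (Z : T3) (s1 s2 s3 : ℝ) : ℝ :=
  bvF (fun sl => bvF (fun ln => bvF (fun x : ℕ => (x : ℝ)) 0 n ln s3) [] n sl s2) [] n Z s1

/-- Shape predicate (`Prop` form). [folklore] -/
def Shape3 {β : Type} (n : ℕ) (Z : List (List (List β))) : Prop :=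
  Z.length = n + 1 ∧ ∀ sl ∈ Z, sl.length = n + 1 ∧ ∀ ln ∈ sl, ln.length = n + 1

/-- The Boolean shape test is correct. [folklore] -/
theorem shape3_of_shapeOK3 {β : Type} (n : ℕ) (Z : List (List (List β))) (h : shapeOK3 n Z = true) :
    Shape3 n Z := by
  simp only [shapeOK3, Bool.and_eq_true, beq_iff_eq, List.all_eq_true] at h
  exact ⟨h.1, fun sl hsl => ⟨(h.2 sl hsl).1, fun ln hln => (h.2 sl hsl).2 ln hln⟩⟩

/-! ### List helpers -/

section Helpers
variable {α β : Type}

/-- An in-range `getD` is a member. [folklore] -/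
theorem getD_mem_of_lt (l : List α) (d : α) {a : ℕ} (h : a < l.length) : l.getD a d ∈ l := by
  rw [List.getD_eq_getElem?_getD, List.getElem?_eq_getElem h, Option.getD_some]
  exact List.getElem_mem h

/-- `lzip` of two lists of length `k` has length `k`. [folklore] -/
theorem lzip_length (add : α → α → α) : ∀ (x y : List α) (k : ℕ), x.length = k → y.length = k →
    (lzip add x y).length = k := by
  intro x
  induction x with
  | nil => intro y k hx hy; cases y with | nil => exact hy | cons _ _ => simp at hx hy; omega
  | cons a x ih =>
    intro y k hx hy
    cases y with
    | nil => simp at hx hy; omega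
    | cons b y =>
      cases k with
      | zero => simp at hx
      | succ k => simp only [lzip, List.length_cons] at hx hy ⊢; rw [ih y k (by omega) (by omega)]

/-- Members of `lzip`. [folklore] -/
theorem lzip_forall (add : α → α → α) (P : α → Prop) (hadd : ∀ a b, P a → P b → P (add a b)) :
    ∀ x y : List α, (∀ a ∈ x, P a) → (∀ b ∈ y, P b) → ∀ w ∈ lzip add x y, P w := by
  intro x
  induction x with
  | nil => intro y _ hy w hw; exact hy w (by simpa [lzip] using hw)
  | cons a x ih =>
    intro y hx hy w hw
    cases y with
    | nil => exact hx w (by simpa [lzip] using hw)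
    | cons b y =>
      simp only [lzip, List.mem_cons] at hw
      rcases hw with rfl | hw
      · exact hadd a b (hx a (by simp)) (hy b (by simp))
      · exact ih y (fun a' ha' => hx a' (by simp [ha'])) (fun b' hb' => hy b' (by simp [hb'])) w hw

/-- Members of `sumRow`. [folklore] -/
theorem sumRow_forall (add : α → α → α) (P : α → Prop) (hadd : ∀ a b, P a → P b → P (add a b)) :
    ∀ l : List α, (∀ a ∈ l, P a) → ∀ w ∈ sumRow add l, P w := by
  intro l
  induction l with
  | nil => intro _ w hw; simp [sumRow] at hw
  | cons a tl ih =>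
    intro hl w hw
    cases tl with
    | nil => simp [sumRow] at hw
    | cons b tl' =>
      have h : sumRow add (a :: b :: tl') = add a b :: sumRow add (b :: tl') := rfl
      rw [h, List.mem_cons] at hw
      rcases hw with rfl | hw
      · exact hadd a b (hl a (by simp)) (hl b (by simp))
      · exact ih (fun x hx => hl x (List.mem_cons_of_mem _ hx)) w hw

/-- Members of `castLAux`. [folklore] -/
theorem castLAux_forall (add : α → α → α) (sc : ℕ → α → α) (P : α → Prop)
    (hadd : ∀ a b, P a → P b → P (add a b)) (hsc : ∀ e a, P a → P (sc e a)) :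
    ∀ (fuel e : ℕ) (row : List α), (∀ a ∈ row, P a) → ∀ w ∈ castLAux add sc fuel e row, P w := by
  intro fuel
  induction fuel with
  | zero => intro e row _ w hw; simp [castLAux] at hw
  | succ fuel ih =>
    intro e row hrow w hw
    cases row with
    | nil => simp [castLAux] at hw
    | cons r0 rest =>
      simp only [castLAux, List.mem_cons] at hw
      rcases hw with rfl | hw
      · exact hsc _ _ (hrow r0 (by simp))
      · exact ih _ _ (sumRow_forall add P hadd _ hrow) w hw

/-- Members of `castL`. [folklore] -/
theorem castL_forall (add : α → α → α) (sc : ℕ → α → α) (P : α → Prop)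
    (hadd : ∀ a b, P a → P b → P (add a b)) (hsc : ∀ e a, P a → P (sc e a)) (b : List α)
    (hb : ∀ a ∈ b, P a) : ∀ w ∈ castL add sc b, P w :=
  castLAux_forall add sc P hadd hsc _ _ _ hb

/-- Members of `castR`. [folklore] -/
theorem castR_forall (add : α → α → α) (sc : ℕ → α → α) (P : α → Prop)
    (hadd : ∀ a b, P a → P b → P (add a b)) (hsc : ∀ e a, P a → P (sc e a)) (b : List α)
    (hb : ∀ a ∈ b, P a) : ∀ w ∈ castR add sc b, P w := by
  intro w hw
  unfold castR at hw
  rw [List.mem_reverse] at hw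
  exact castL_forall add sc P hadd hsc _ (fun a ha => hb a (List.mem_reverse.1 ha)) w hw

/-- `pvF` only depends on `F` at members. [folklore] -/
theorem pvF_congr_mem {F F' : α → ℝ} : ∀ (l : List α) (x : ℝ), (∀ a ∈ l, F a = F' a) → pvF F l x = pvF F' l x := by
  intro l
  induction l with
  | nil => intro x _; rfl
  | cons c cs ih =>
    intro x h
    simp only [pvF]
    rw [h c (by simp), ih x (fun a ha => h a (by simp [ha]))]

/-- `pvF` of a mapped list. [folklore] -/
theorem pvF_map {F : α → ℝ} (g : β → α) : ∀ (l : List β) (x : ℝ), pvF F (l.map g) x = pvF (F ∘ g) l x := by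
  intro l
  induction l with
  | nil => intro x; rfl
  | cons c cs ih => intro x; simp only [List.map_cons, pvF, ih, Function.comp]

/-- In-range entries of a mapped list (any defaults). [folklore] -/
theorem getD_map_of_lt (g : β → α) (x : List β) {a : ℕ} (h : a < x.length) (d : α) (d' : β) :
    (x.map g).getD a d = g (x.getD a d') := by
  rw [List.getD_eq_getElem?_getD, List.getD_eq_getElem?_getD, List.getElem?_map, List.getElem?_eq_getElem h]
  rfl

/-- `bvF` of a mapped list, hypothesis only at members. [folklore] -/
theorem bvF_map_mem {F : α → ℝ} {z : α} {F' : β → ℝ} {z' : β} (g : β → α) (c : ℝ)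
    (hz : F z = 0) (hz' : F' z' = 0) (n : ℕ) (s : ℝ) (x : List β)
    (hFg : ∀ w ∈ x, F (g w) = c * F' w) :
    bvF F z n (x.map g) s = c * bvF F' z' n x s := by
  unfold bvF
  rw [Finset.mul_sum]
  refine Finset.sum_congr rfl fun a _ => ?_
  by_cases ha : a < x.length
  · rw [getD_map_of_lt g x ha z z', hFg _ (getD_mem_of_lt x z' ha)]; ring
  · push Not at ha
    rw [List.getD_eq_default _ _ (by rw [List.length_map]; exact ha), List.getD_eq_default _ _ ha, hz, hz']; ring

/-- An affine entrywise bound lifts through `bvF` on `[0,1]` (upper; full-length lists). [folklore] -/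
theorem bvF_map_le_affine {F : α → ℝ} {z : α} {F' : β → ℝ} {z' : β} (g : β → α) (N M : ℝ) (n : ℕ)
    {s : ℝ} (h0 : 0 ≤ s) (h1 : s ≤ 1) (x : List β) (hx : x.length = n + 1)
    (hle : ∀ w ∈ x, F (g w) ≤ N * F' w + M) :
    bvF F z n (x.map g) s ≤ N * bvF F' z' n x s + M := by
  unfold bvF
  have hpt : ∀ a ∈ range (n + 1), bern n a s * F ((x.map g).getD a z) ≤ bern n a s * (N * F' (x.getD a z') + M) := by
    intro a ha
    have ha' : a < x.length := by rw [hx]; simpa using ha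
    refine mul_le_mul_of_nonneg_left ?_ (bern_nonneg n a h0 h1)
    rw [getD_map_of_lt g x ha' z z']
    exact hle _ (getD_mem_of_lt x z' ha')
  calc _ ≤ ∑ a ∈ range (n + 1), bern n a s * (N * F' (x.getD a z') + M) := Finset.sum_le_sum hpt
    _ = N * ∑ a ∈ range (n + 1), bern n a s * F' (x.getD a z') + M * ∑ a ∈ range (n + 1), bern n a s := by
        rw [Finset.mul_sum, Finset.mul_sum, ← Finset.sum_add_distrib]
        refine Finset.sum_congr rfl fun a _ => ?_; ring
    _ = _ := by rw [sum_bern, mul_one]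

/-- An affine entrywise bound lifts through `bvF` on `[0,1]` (lower; full-length lists). [folklore] -/
theorem le_bvF_map_affine {F : α → ℝ} {z : α} {F' : β → ℝ} {z' : β} (g : β → α) (N M : ℝ) (n : ℕ)
    {s : ℝ} (h0 : 0 ≤ s) (h1 : s ≤ 1) (x : List β) (hx : x.length = n + 1)
    (hle : ∀ w ∈ x, N * F' w + M ≤ F (g w)) :
    N * bvF F' z' n x s + M ≤ bvF F z n (x.map g) s := by
  unfold bvF
  have hpt : ∀ a ∈ range (n + 1), bern n a s * (N * F' (x.getD a z') + M) ≤ bern n a s * F ((x.map g).getD a z) := by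
    intro a ha
    have ha' : a < x.length := by rw [hx]; simpa using ha
    refine mul_le_mul_of_nonneg_left ?_ (bern_nonneg n a h0 h1)
    rw [getD_map_of_lt g x ha' z z']
    exact hle _ (getD_mem_of_lt x z' ha')
  calc N * ∑ a ∈ range (n + 1), bern n a s * F' (x.getD a z') + M
      = N * ∑ a ∈ range (n + 1), bern n a s * F' (x.getD a z') + M * ∑ a ∈ range (n + 1), bern n a s := by
        rw [sum_bern, mul_one]
    _ = ∑ a ∈ range (n + 1), bern n a s * (N * F' (x.getD a z') + M) := by
        rw [Finset.mul_sum, Finset.mul_sum, ← Finset.sum_add_distrib]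
        refine Finset.sum_congr rfl fun a _ => ?_; ring
    _ ≤ _ := Finset.sum_le_sum hpt

end Helpers

end Summit.Ventures.Crystal3D.CapCut.Bern
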